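import Mathlib.NumberTheory.Padics.RingHoms
import Literature.NumberTheory.EllipticCurves.TwoIsogenySelmerGroup
import Literature.NumberTheory.EllipticCurves.BinaryQuarticLocalSolubility
import HarnessLib

/-!
# Route IsogenyRedei, crux `PencilSelmerDictionary` (stmt-Parity-11584), line
# `toric-node-vacuity-cassels`, Stub D: the `2`-adic entry on the dual side

For the pencil `E_t : y² = x³ + 2t·x² + (t² + 1)·x` the dual `2`-isogeny descent runs over the
divisors of `b' = a² - 4b = -4`; the class of `2` has homogeneous space
`w² = Q(u, z) := 2u⁴ - 4t·u²z² - 2z⁴`, i.e. the integral binary quartic form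
`twoIsogenyQuartic (-4t) 2 (-2) = ⟨2, 0, -4t, 0, -2⟩`. This file decides its `ℚ₂`-solubility:

`stub_dualSideTwoAdic : (Q is ℚ₂-soluble) ↔ t ≡ 0 (mod 4) ∨ t ≡ 7 (mod 8)` (`t ≥ 1`).

* (⇒) A `ℚ₂`-point reduces (through one of the two affine charts of `ℙ¹(ℤ₂)`) to a solution of
  `w² = Q(1, x)` or `w² = Q(x, 1)` in `ZMod 32`; for `t mod 8 ∈ {1, 2, 3, 5, 6}` neither value is a
  square modulo `32` (`dual_no_sq_mod32`, by `decide`).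
* (⇐) Hensel at `2` (`isSoluble_two_of_dvd`: an integral point with `Q ≡ 4^k·w² (mod 2^{2k+3})`,
  `w` odd, lifts): for `t ≡ 7 (mod 8)` the point `(1, 1)` has `Q = -4t ≡ 4 (mod 32)` (`k = 1`);
  for `t ≡ 4 (mod 8)` some `u` has `Q(u, 1) ≡ 16 (mod 128)` (`k = 2`, `dual_wit_mod128`); for
  `t ≡ 0 (mod 8)` some `u` has `Q(u, 1) ≡ 64 (mod 512)` (`k = 3`, `dual_wit_mod512`).

The generic tools (`exists_zmod_of_isSoluble_padic_of_dvd`, `isSoluble_two_of_dvd`, …) are private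
copies of the lead's `IsogenyRedeiPencilSelmerDictionaryTools` lemmas.

## References

* J. H. Silverman, *The Arithmetic of Elliptic Curves*, 2nd ed., GTM 106 (2009), Prop. X.4.9.
-/

noncomputable section

open scoped Classical

namespace Summit.Parity.BatemanHorn.Theorems.PencilSelmerDictionary

open Literature.NumberTheory.EllipticCurves
open Literature.NumberTheory.EllipticCurves.BinaryQuartic

/-! ## Private copies of the shared tools -/

/-- The value of the integral form: `q(u, z) = d u⁴ + a u²z² + d' z⁴`. [folklore] -/
private theorem eval_twoIsogenyQuartic_D (a d d' u z : ℤ) :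
    (twoIsogenyQuartic a d d').eval u z = d * u ^ 4 + a * u ^ 2 * z ^ 2 + d' * z ^ 4 := by
  simp only [twoIsogenyQuartic, BinaryQuartic.eval]
  ring

/-- Functoriality of `map` on integral forms: mapping along `ℤ → R → S` is mapping along `ℤ → S`.
[folklore] -/
private theorem map_map_intCast_D {R S : Type*} [CommRing R] [CommRing S] (f : BinaryQuartic ℤ)
    (g : R →+* S) : (f.map (Int.castRingHom R)).map g = f.map (Int.castRingHom S) := by
  ext <;> simp [BinaryQuartic.map]

/-- Evaluation of an integral form commutes with casting the arguments. [folklore] -/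
private theorem eval_map_intCast_D {R : Type*} [CommRing R] (f : BinaryQuartic ℤ) (x y : ℤ) :
    (f.map (Int.castRingHom R)).eval (x : R) (y : R) = ((f.eval x y : ℤ) : R) := by
  have := eval_map (Int.castRingHom R) f x y
  simpa using this

/-- **Residue exhaustion engine.** If the integral form `f` has a `ℚ_p`-point then, for every `n`,
`w² = f(1, x)` or `w² = f(x, 1)` is soluble in `ZMod (p ^ n)`. [folklore] -/
private theorem exists_zmod_of_isSoluble_padic_D {p : ℕ} [Fact p.Prime] (n : ℕ)
    (f : BinaryQuartic ℤ) (h : (f.map (Int.castRingHom ℚ_[p])).IsSoluble) :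
    ∃ x w : ZMod (p ^ n),
      w ^ 2 = (f.map (Int.castRingHom (ZMod (p ^ n)))).eval 1 x ∨
        w ^ 2 = (f.map (Int.castRingHom (ZMod (p ^ n)))).eval x 1 := by
  rw [← map_intCast_map_coe] at h
  have hφ : ∀ t z : ℤ_[p], ∀ u v : ℤ_[p],
      z ^ 2 = (f.map (Int.castRingHom ℤ_[p])).eval u v →
        (PadicInt.toZModPow n z) ^ 2 =
          (f.map (Int.castRingHom (ZMod (p ^ n)))).eval (PadicInt.toZModPow n u)
            (PadicInt.toZModPow n v) := by
    intro t z u v hz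
    have := congrArg (PadicInt.toZModPow n) hz
    rw [map_pow, ← eval_map, map_map_intCast_D] at this
    exact this
  rcases (isSoluble_map_coe_iff _).mp h with ⟨t, z, htz⟩ | ⟨t, z, htz⟩
  · refine ⟨PadicInt.toZModPow n t, PadicInt.toZModPow n z, Or.inl ?_⟩
    simpa using hφ t z 1 t htz
  · refine ⟨PadicInt.toZModPow n t, PadicInt.toZModPow n z, Or.inr ?_⟩
    simpa using hφ t z t 1 htz

/-- **Residue exhaustion engine, concrete modulus.** If the integral form `f` has a `ℚ_p`-point
and `m ∣ p ^ n`, then `w² = f(1, x)` or `w² = f(x, 1)` is soluble in `ZMod m`. [folklore] -/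
private theorem exists_zmod_of_isSoluble_padic_of_dvd_D {p : ℕ} [Fact p.Prime] {m n : ℕ}
    (hm : m ∣ p ^ n) (f : BinaryQuartic ℤ) (h : (f.map (Int.castRingHom ℚ_[p])).IsSoluble) :
    ∃ x w : ZMod m,
      w ^ 2 = (f.map (Int.castRingHom (ZMod m))).eval 1 x ∨
        w ^ 2 = (f.map (Int.castRingHom (ZMod m))).eval x 1 := by
  obtain ⟨x, w, hxw⟩ := exists_zmod_of_isSoluble_padic_D n f h
  have hφ : ∀ u v : ZMod (p ^ n), w ^ 2 = (f.map (Int.castRingHom (ZMod (p ^ n)))).eval u v →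
      (ZMod.castHom hm (ZMod m) w) ^ 2 =
        (f.map (Int.castRingHom (ZMod m))).eval (ZMod.castHom hm (ZMod m) u)
          (ZMod.castHom hm (ZMod m) v) := by
    intro u v huv
    have := congrArg (ZMod.castHom hm (ZMod m)) huv
    rw [map_pow, ← eval_map, map_map_intCast_D] at this
    exact this
  refine ⟨ZMod.castHom hm (ZMod m) x, ZMod.castHom hm (ZMod m) w, ?_⟩
  rcases hxw with hxw | hxw
  · left
    have := hφ 1 x hxw
    rwa [map_one] at this
  · right
    have := hφ x 1 hxw
    rwa [map_one] at this

/-- An odd integer is a `2`-adic unit. [folklore] -/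
private theorem norm_intCast_eq_one_of_odd_D {w : ℤ} (hw : Odd w) : ‖((w : ℤ_[2]))‖ = 1 := by
  rcases (PadicInt.norm_le_one (w : ℤ_[2])).lt_or_eq with h | h
  · exfalso
    rw [PadicInt.norm_int_lt_one_iff_dvd] at h
    have h2 : (2 : ℤ) ∣ w := by exact_mod_cast h
    exact (Int.not_even_iff_odd.mpr hw) (even_iff_two_dvd.mpr h2)
  · exact h

/-- **`2`-adic solubility from an approximate point** (Hensel): if `(x, y) ≠ (0, 0)` are integers
and `f(x, y) ≡ 4^k · w² (mod 2^{2k+3})` with `w` odd, then `f` is `ℚ₂`-soluble. [folklore] -/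
private theorem isSoluble_two_of_dvd_D (f : BinaryQuartic ℤ) {x y : ℤ} (hxy : x ≠ 0 ∨ y ≠ 0)
    (k : ℕ) {w : ℤ} (hw : Odd w) (h : (2 : ℤ) ^ (2 * k + 3) ∣ f.eval x y - 4 ^ k * w ^ 2) :
    (f.map (Int.castRingHom ℚ_[2])).IsSoluble := by
  obtain ⟨m, hm⟩ := h
  have hval : f.eval x y = 4 ^ k * (w ^ 2 + 8 * m) := by
    have h48 : (2 : ℤ) ^ (2 * k + 3) = 4 ^ k * 8 := by
      rw [pow_add, pow_mul]; norm_num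
    rw [h48] at hm
    linear_combination hm
  -- `w² + 8m` is a square in `ℤ₂`
  obtain ⟨s, hs⟩ : ∃ s : ℤ_[2], s ^ 2 = ((w ^ 2 + 8 * m : ℤ) : ℤ_[2]) := by
    apply exists_sq_eq_of_norm_sub_lt (z := ((w : ℤ) : ℤ_[2]))
    have hwn : ‖((w : ℤ) : ℤ_[2])‖ = 1 := norm_intCast_eq_one_of_odd_D hw
    have h2 : ‖(2 : ℤ_[2])‖ = 2⁻¹ := by
      have := PadicInt.norm_p (p := 2)
      exact_mod_cast this
    have hsub : ((w : ℤ) : ℤ_[2]) ^ 2 - ((w ^ 2 + 8 * m : ℤ) : ℤ_[2]) =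
        ((-(8 * m) : ℤ) : ℤ_[2]) := by
      push_cast; ring
    rw [hsub, norm_mul, h2, hwn, mul_one]
    have hle : ‖((-(8 * m) : ℤ) : ℤ_[2])‖ ≤ (2 : ℝ) ^ (-(3 : ℕ) : ℤ) :=
      PadicInt.norm_int_le_pow_iff_dvd.mpr ⟨-m, by ring⟩
    calc ‖((-(8 * m) : ℤ) : ℤ_[2])‖ ≤ (2 : ℝ) ^ (-(3 : ℕ) : ℤ) := hle
      _ < (2⁻¹) ^ 2 := by norm_num
  -- the `ℤ₂`-point `(x, y, 2^k s)`
  rw [← map_intCast_map_coe]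
  refine isSoluble_map_coe_of_eval_eq_sq _ (x := ((x : ℤ) : ℤ_[2])) (y := ((y : ℤ) : ℤ_[2]))
    (z := (2 : ℤ_[2]) ^ k * s) ?_ ?_
  · rcases hxy with hx | hy
    · exact Or.inl (by exact_mod_cast hx)
    · exact Or.inr (by exact_mod_cast hy)
  · have h4 : (4 : ℤ_[2]) ^ k = (2 : ℤ_[2]) ^ (k * 2) := by
      rw [mul_comm, pow_mul]; norm_num
    rw [eval_map_intCast_D, hval, mul_pow, ← pow_mul, hs]
    push_cast
    rw [h4]

/-! ## The three finite verifications -/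

/-- For `t mod 8 ∈ {1, 2, 3, 5, 6}` neither `Q(x, 1) = 2x⁴ - 4t x² - 2` nor
`Q(1, x) = 2 - 4t x² - 2x⁴` is a square modulo `32`. [folklore] -/
private theorem dual_no_sq_mod32 : ∀ T x : ZMod 32,
    (T.val % 8 = 1 ∨ T.val % 8 = 2 ∨ T.val % 8 = 3 ∨ T.val % 8 = 5 ∨ T.val % 8 = 6) →
      (2 * x ^ 4 - 4 * T * x ^ 2 - 2) ∉ (Finset.univ.image fun w : ZMod 32 => w ^ 2) ∧
      (2 - 4 * T * x ^ 2 - 2 * x ^ 4) ∉ (Finset.univ.image fun w : ZMod 32 => w ^ 2) := by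
  decide

set_option maxRecDepth 16000 in
/-- For `t ≡ 4 (mod 8)` there is `u` with `Q(u, 1) ≡ 16 (mod 128)`. [folklore] -/
private theorem dual_wit_mod128 : ∀ T : ZMod 128, T.val % 8 = 4 →
    ∃ u : ZMod 128, 2 * u ^ 4 - 4 * T * u ^ 2 - 2 = 16 := by
  decide

set_option maxRecDepth 16000 in
/-- For `t ≡ 0 (mod 8)` there is `u` with `Q(u, 1) ≡ 64 (mod 512)`. [folklore] -/
private theorem dual_wit_mod512 : ∀ T : ZMod 512, T.val % 8 = 0 →
    ∃ u : ZMod 512, 2 * u ^ 4 - 4 * T * u ^ 2 - 2 = 64 := by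
  decide

/-! ## Hensel lifts of the witnesses -/

/-- Lifting a residue witness: if `Q(u, 1) = 4^k` in `ZMod m` with `m = 2^{2k+3}`, then `Q` is
`ℚ₂`-soluble. [folklore] -/
private theorem isSoluble_of_zmod_witness (t : ℕ) (k : ℕ) (u : ZMod (2 ^ (2 * k + 3)))
    (hu : 2 * u ^ 4 - 4 * (t : ZMod (2 ^ (2 * k + 3))) * u ^ 2 - 2 = 4 ^ k) :
    ((twoIsogenyQuartic (-4 * (t : ℤ)) 2 (-2)).map (Int.castRingHom ℚ_[2])).IsSoluble := by
  haveI : NeZero (2 ^ (2 * k + 3)) := ⟨pow_ne_zero _ two_ne_zero⟩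
  refine isSoluble_two_of_dvd_D _ (x := (u.val : ℤ)) (y := 1) (Or.inr one_ne_zero) k (w := 1)
    odd_one ?_
  rw [eval_twoIsogenyQuartic_D]
  have hm : ((2 : ℤ) ^ (2 * k + 3)) = ((2 ^ (2 * k + 3) : ℕ) : ℤ) := by push_cast; rfl
  rw [hm, ← ZMod.intCast_zmod_eq_zero_iff_dvd]
  push_cast
  rw [ZMod.natCast_zmod_val]
  linear_combination hu

/-! ## The stub -/

/-- **Stub D (dual side, `p = 2`).** For `t ≥ 1`, the homogeneous space
`w² = 2u⁴ - 4t u²z² - 2z⁴` of the dual `2`-isogeny descent of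
`E_t : y² = x³ + 2t x² + (t² + 1) x` is `ℚ₂`-soluble iff `t ≡ 0 (mod 4)` or `t ≡ 7 (mod 8)`.
[folklore] -/
theorem stub_dualSideTwoAdic :
    ∀ t : ℕ, 1 ≤ t →
      (((twoIsogenyQuartic (-4 * (t : ℤ)) 2 (-2)).map (Int.castRingHom ℚ_[2])).IsSoluble ↔
        (t % 4 = 0 ∨ t % 8 = 7)) := by
  intro t _
  constructor
  · -- (⇒): residues modulo 32
    intro hsol
    by_contra hcon
    obtain ⟨x, w, hxw⟩ :=
      exists_zmod_of_isSoluble_padic_of_dvd_D (p := 2) (m := 32) (n := 5) (by norm_num) _ hsol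
    have hT : ((t : ZMod 32)).val % 8 = 1 ∨ ((t : ZMod 32)).val % 8 = 2 ∨
        ((t : ZMod 32)).val % 8 = 3 ∨ ((t : ZMod 32)).val % 8 = 5 ∨
        ((t : ZMod 32)).val % 8 = 6 := by
      rw [ZMod.val_natCast]
      omega
    have key := dual_no_sq_mod32 (t : ZMod 32) x hT
    have e1 : ((twoIsogenyQuartic (-4 * (t : ℤ)) 2 (-2)).map (Int.castRingHom (ZMod 32))).eval 1 x
        = 2 - 4 * (t : ZMod 32) * x ^ 2 - 2 * x ^ 4 := by
      rw [eval_map_twoIsogenyQuartic]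
      simp only [eq_intCast, Int.cast_neg, Int.cast_mul, Int.cast_ofNat, Int.cast_natCast]
      ring
    have e2 : ((twoIsogenyQuartic (-4 * (t : ℤ)) 2 (-2)).map (Int.castRingHom (ZMod 32))).eval x 1
        = 2 * x ^ 4 - 4 * (t : ZMod 32) * x ^ 2 - 2 := by
      rw [eval_map_twoIsogenyQuartic]
      simp only [eq_intCast, Int.cast_neg, Int.cast_mul, Int.cast_ofNat, Int.cast_natCast]
      ring
    rcases hxw with h | h
    · exact key.2 (Finset.mem_image.mpr ⟨w, Finset.mem_univ _, by rw [h, e1]⟩)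
    · exact key.1 (Finset.mem_image.mpr ⟨w, Finset.mem_univ _, by rw [h, e2]⟩)
  · -- (⇐): Hensel lifts
    intro h
    have h3 : t % 8 = 7 ∨ t % 8 = 4 ∨ t % 8 = 0 := by omega
    rcases h3 with h7 | h4 | h0
    · -- `t ≡ 7 (mod 8)`: the point `(1, 1)`, `Q(1, 1) = -4t ≡ 4 (mod 32)`
      obtain ⟨k, hk⟩ : ∃ k, t = 8 * k + 7 := ⟨t / 8, by omega⟩
      refine isSoluble_two_of_dvd_D _ (x := 1) (y := 1) (Or.inl one_ne_zero) 1 (w := 1) odd_one ?_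
      rw [eval_twoIsogenyQuartic_D]
      refine ⟨-(k : ℤ) - 1, ?_⟩
      subst hk
      push_cast
      ring
    · -- `t ≡ 4 (mod 8)`: `Q(u, 1) ≡ 16 (mod 128)`
      have hT : ((t : ZMod 128)).val % 8 = 4 := by
        rw [ZMod.val_natCast]
        omega
      obtain ⟨u, hu⟩ := dual_wit_mod128 (t : ZMod 128) hT
      exact isSoluble_of_zmod_witness t 2 u (by norm_num; exact hu)
    · -- `t ≡ 0 (mod 8)`: `Q(u, 1) ≡ 64 (mod 512)`
      have hT : ((t : ZMod 512)).val % 8 = 0 := by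
        rw [ZMod.val_natCast]
        omega
      obtain ⟨u, hu⟩ := dual_wit_mod512 (t : ZMod 512) hT
      exact isSoluble_of_zmod_witness t 3 u (by norm_num; exact hu)

end Summit.Parity.BatemanHorn.Theorems.PencilSelmerDictionary

end
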